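import Literature.AnabelianGeometry.Anabelioids.ComponentsOrbits
import Literature.AnabelianGeometry.Anabelioids.FibreRangeSubobjects
import Literature.AnabelianGeometry.SemiGraphs.ProperBranchLifting
import Literature.AnabelianGeometry.SemiGraphs.FiniteEtaleCoveringDictionaryProofs3
import Literature.AnabelianGeometry.SemiGraphs.GraphOfAnabelioidsLimits
import Literature.AnabelianGeometry.SemiGraphs.GraphOfAnabelioidsComplements

/-!
# The finite étale covering dictionary ([SemiAnbd] §2) — proofs: (D8) the covering attached to a
# connected object is connected

Mochizuki, *Semi-graphs of anabelioids*, Publ. RIMS **42** (2006), §2 p. 23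
[cite: MochizukiSemiAnbd2006, Def. 2.2(i) p.23] (the covering `𝒢' → 𝒢` attached to `G' ∈ B(𝒢)`:
"we assume that `B'` is connected"; its vertices / edges over `v` / `e` "correspond to the
connected components of `S_v`" / `T_e`) with p. 30 ("a connected finite … étale covering
`𝒢' → 𝒢`").  Dictionary fact (D8) `covering_isConnected` of `FiniteEtaleCoveringDictionary.lean`
(abc-iut-L3-d3), DISCHARGED: `covering_isConnected_holds`.

Proof.  Let `K` be a connected component of the barycentric subdivision of `𝔾'`.  Through the
bijections `v' ↦ (φ v', cV v')`, `e' ↦ (φ e', cE e')` of `IsFiniteEtaleCoveringOf`, `K` singles out,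
over each vertex `v` (edge `e`) of `𝔾`, a set of connected components of `S_v` (`T_e`); their
disjoint unions `Z_v ↪ S_v`, `Z_e ↪ T_e` (monomorphisms: distinct components have disjoint fibres,
`mono_sigmaDesc_of_pairwise_disjoint`) glue to a sub-object `Z ↪ A` of `B(𝒢)` because, along a branch
`b` of `e` abutting to `v`, **the components of `T_e` lying under `ψ_b(b^* P)`, `P = cV v'`, are
exactly the `cE e'` for the edges `e'` having a branch over `b` abutting to `v'`**
(`range_iUnion_eq`: properness of `φ` lifts `b` into every `e'` over `e` — `ProperBranchLifting`; the
branch clause of `IsFiniteEtaleCoveringOf` puts `cE e'` under `ψ_b(b^* cV v')`; distinct components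
are disjoint — `ComponentsOrbits`), and `K` is closed under incidence.  `Z` is non-initial, so by
connectedness of `A` the monomorphism `Z ↪ A` is an isomorphism; hence every component, i.e. every
vertex and edge of `𝔾'`, belongs to `K`.  Proof-only.
-/

namespace Literature.AnabelianGeometry.SemiGraphs

open CategoryTheory CategoryTheory.Limits CategoryTheory.PreGaloisCategory
open Literature.AnabelianGeometry.Anabelioids

universe v₁ u₁ u

namespace SemiGraphOfAnabelioids

variable {𝒢 : SemiGraphOfAnabelioids.{v₁, u₁, u}}

/-! ### Non-initiality of all constituents of a non-initial object over a connected semi-graph -/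

/-- A predicate respected by adjacency is constant along reachability. [folklore] -/
private theorem iff_of_reachable' {V : Type*} {G : SimpleGraph V} (Q : V → Prop)
    (h : ∀ ⦃a b : V⦄, G.Adj a b → (Q a ↔ Q b)) {u v : V} (huv : G.Reachable u v) : Q u ↔ Q v := by
  obtain ⟨p⟩ := huv
  induction p with
  | nil => exact Iff.rfl
  | cons hadj _ ih => exact (h hadj).trans ih

/-- Over a connected semi-graph, NO constituent (vertex or edge) of a non-initial object of `B(𝒢)`
is initial. [cite: MochizukiSemiAnbd2006, Def. 2.1 p.23] -/
theorem BObj.not_isInitial_constituents (h𝒢 : 𝒢.IsConnected) (A : 𝒢.BObj)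
    (hA : IsInitial A → False) :
    (∀ v, IsInitial (A.S v) → False) ∧ ∀ e, IsInitial (A.T e) → False := by
  classical
  let Q : 𝒢.graph.Node → Prop := fun n =>
    match n with
    | Sum.inl w => IsInitial (A.S w) → False
    | Sum.inr (Sum.inl e) => IsInitial (A.T e) → False
    | Sum.inr (Sum.inr b) => IsInitial (A.T (𝒢.graph.edgeOf b)) → False
  have hQ : ∀ ⦃m n : 𝒢.graph.Node⦄, 𝒢.graph.subdivision.Adj m n → (Q m ↔ Q n) := by
    have key : ∀ ⦃m n : 𝒢.graph.Node⦄, 𝒢.graph.NodeRel m n → (Q m ↔ Q n) := by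
      rintro _ _ (⟨b⟩ | ⟨b, w, hw⟩)
      · exact Iff.rfl
      · exact (A.not_isInitial_S_iff b w hw).symm
    intro m n hmn
    rw [SemiGraph.subdivision, SimpleGraph.fromRel_adj] at hmn
    rcases hmn.2 with hr | hr
    · exact key hr
    · exact (key hr).symm
  have hconst : ∀ m n : 𝒢.graph.Node, Q m ↔ Q n := fun m n =>
    iff_of_reachable' Q hQ (h𝒢.isConnected.connected.preconnected m n)
  have hex : ∃ n, Q n := by
    by_contra hnone
    push Not at hnone
    refine hA (A.nonempty_isInitial_of_components (fun w => ?_) (fun e => ?_)).some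
    · by_contra hne
      exact hnone (Sum.inl w) fun hi => hne ⟨hi⟩
    · by_contra hne
      exact hnone (Sum.inr (Sum.inl e)) fun hi => hne ⟨hi⟩
  obtain ⟨n₀, hn₀⟩ := hex
  exact ⟨fun v => (hconst n₀ (Sum.inl v)).mp hn₀, fun e => (hconst n₀ (Sum.inr (Sum.inl e))).mp hn₀⟩

/-! ### Transport of components along equalities of edges -/

/-- Heterogeneously equal components over (propositionally) equal edges are equal after transport.
[cite: MochizukiSemiAnbd2006, Def. 2.2(i) p.23] -/
private theorem eqRec_component_eq (A : 𝒢.BObj) {e₁ e₂ : 𝒢.graph.Edge} (h : e₁ = e₂)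
    (Q₂ : π₀Obj (A.T e₂)) (Q₁ : π₀Obj (A.T e₁)) (hQ : HEq Q₂ Q₁) :
    (h ▸ Q₂ : π₀Obj (A.T e₁)) = Q₁ := by
  subst h
  exact eq_of_heq hQ

/-- `⟨e₁, h ▸ Q⟩ = ⟨e₂, Q⟩` in the Σ-type of edge components. [cite: MochizukiSemiAnbd2006, Def. 2.2(i) p.23] -/
private theorem sigma_mk_eqRec (A : 𝒢.BObj) {e₁ e₂ : 𝒢.graph.Edge} (h : e₁ = e₂)
    (Q : π₀Obj (A.T e₂)) :
    (⟨e₁, (h ▸ Q : π₀Obj (A.T e₁))⟩ : Σ e, π₀Obj (A.T e)) = ⟨e₂, Q⟩ := by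
  subst h
  rfl

/-- The branch clause of `IsFiniteEtaleCoveringOf`, read at the home edge `e₁ = edgeOf (φ b')` as an
inclusion of fibre-images: the (transported) component lies under the image of `g`.
[cite: MochizukiSemiAnbd2006, Def. 2.2(i) p.23] -/
private theorem range_subset_of_branchClause (A : 𝒢.BObj) {e₁ e₂ : 𝒢.graph.Edge} (h : e₁ = e₂)
    (F : 𝒢.E e₁ ⥤ FintypeCat.{v₁}) {X : 𝒢.E e₁} (g : X ⟶ A.T e₁) (Q : π₀Obj (A.T e₂))
    (f : (Q.1 : 𝒢.E e₂) ⟶ (𝒢.transportE h).obj X)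
    (hf : f ≫ (𝒢.transportE h).map g ≫ eqToHom (𝒢.transportE_obj_T A h) = Q.1.arrow) :
    Set.range (F.map (h ▸ Q : π₀Obj (A.T e₁)).1.arrow) ⊆ Set.range (F.map g) := by
  subst h
  change f ≫ g ≫ eqToHom rfl = Q.1.arrow at hf
  rw [eqToHom_refl, Category.comp_id] at hf
  change Set.range (F.map Q.1.arrow) ⊆ _
  rintro x ⟨q, rfl⟩
  refine ⟨F.map f q, ?_⟩
  have := congrArg (fun k => F.map k q) hf
  simp only [F.map_comp, FintypeCat.comp_apply] at this
  exact this

/-! ### (D8) -/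

/-- NAMED FACT (D8) `covering_isConnected`, PROVED: the finite étale covering attached to a connected
object `A ∈ B(𝒢)` of a connected semi-graph of anabelioids is connected.
[cite: MochizukiSemiAnbd2006, Def. 2.2(i) p.23] -/
theorem covering_isConnected_holds : covering_isConnected.{v₁, u₁, u} := by
  intro 𝒢 𝒢' φ A h𝒢 hφ hA
  classical
  obtain ⟨hprop, cV, cE, hbijV, hbijE, -, -, hbr⟩ := hφ
  -- fibre functors of the constituents of `𝒢`
  let FV : ∀ v : 𝒢.graph.Vertex, 𝒢.V v ⥤ FintypeCat.{v₁} := fun v =>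
    GaloisCategory.getFiberFunctor (𝒢.V v)
  let FE : ∀ e : 𝒢.graph.Edge, 𝒢.E e ⥤ FintypeCat.{v₁} := fun e =>
    GaloisCategory.getFiberFunctor (𝒢.E e)
  -- the component bijections and their inverses
  let σV : 𝒢'.graph.Vertex → Σ v, π₀Obj (A.S v) := fun v' => ⟨φ.base.vertexMap v', cV v'⟩
  let σE : 𝒢'.graph.Edge → Σ e, π₀Obj (A.T e) := fun e' => ⟨φ.base.edgeMap e', cE e'⟩
  let τV : (Σ v, π₀Obj (A.S v)) → 𝒢'.graph.Vertex := Function.surjInv hbijV.2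
  let τE : (Σ e, π₀Obj (A.T e)) → 𝒢'.graph.Edge := Function.surjInv hbijE.2
  have hστV : ∀ x, σV (τV x) = x := Function.surjInv_eq hbijV.2
  have hτσV : ∀ v', τV (σV v') = v' := Function.leftInverse_surjInv hbijV
  have hστE : ∀ x, σE (τE x) = x := Function.surjInv_eq hbijE.2
  have hτσE : ∀ e', τE (σE e') = e' := Function.leftInverse_surjInv hbijE
  -- no constituent of `A` is initial
  obtain ⟨hSv, hTe⟩ := BObj.not_isInitial_constituents h𝒢 A fun h => hA.notInitial h
  -- a base node of `𝔾'`
  have hnode : Nonempty (𝒢'.graph.Vertex ⊕ 𝒢'.graph.Edge) := by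
    obtain ⟨n⟩ := h𝒢.isConnected.connected.nonempty
    rcases n with v | e | b
    · obtain ⟨P⟩ := nonempty_π₀Obj (A.S v) (hSv v)
      exact ⟨Sum.inl (τV ⟨v, P⟩)⟩
    · obtain ⟨Q⟩ := nonempty_π₀Obj (A.T e) (hTe e)
      exact ⟨Sum.inr (τE ⟨e, Q⟩)⟩
    · obtain ⟨Q⟩ := nonempty_π₀Obj (A.T (𝒢.graph.edgeOf b)) (hTe _)
      exact ⟨Sum.inr (τE ⟨_, Q⟩)⟩
  obtain ⟨n₀, hn₀⟩ : ∃ n₀ : 𝒢'.graph.Node,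
      (∃ v', n₀ = Sum.inl v') ∨ ∃ e', n₀ = Sum.inr (Sum.inl e') := by
    obtain ⟨c₀⟩ := hnode
    rcases c₀ with v' | e'
    exacts [⟨_, Or.inl ⟨v', rfl⟩⟩, ⟨_, Or.inr ⟨e', rfl⟩⟩]
  -- its connected component `K`
  let K : 𝒢'.graph.Node → Prop := fun n => 𝒢'.graph.subdivision.Reachable n₀ n
  have hK₀ : K n₀ := SimpleGraph.Reachable.refl _
  have hKadj : ∀ {m n : 𝒢'.graph.Node}, 𝒢'.graph.NodeRel m n → (K m ↔ K n) := by
    intro m n hmn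
    have hadj : 𝒢'.graph.subdivision.Adj m n ∨ m = n := by
      by_cases hne : m = n
      · exact Or.inr hne
      · left
        rw [SemiGraph.subdivision, SimpleGraph.fromRel_adj]
        exact ⟨hne, Or.inl hmn⟩
    rcases hadj with hadj | rfl
    · exact ⟨fun hm => hm.trans hadj.reachable, fun hn => hn.trans hadj.symm.reachable⟩
    · exact Iff.rfl
  have hKeb : ∀ b' : 𝒢'.graph.Branch,
      K (Sum.inr (Sum.inl (𝒢'.graph.edgeOf b'))) ↔ K (Sum.inr (Sum.inr b')) :=
    fun b' => hKadj (SemiGraph.NodeRel.edge_branch b')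
  have hKbv : ∀ (b' : 𝒢'.graph.Branch) (v' : 𝒢'.graph.Vertex),
      𝒢'.graph.abuts b' = some v' → (K (Sum.inr (Sum.inr b')) ↔ K (Sum.inl v')) :=
    fun b' v' h' => hKadj (SemiGraph.NodeRel.branch_vertex b' v' h')
  -- the components over `v`, `e` singled out by `K`
  let KV : ∀ v, Set (π₀Obj (A.S v)) := fun v => {P | K (Sum.inl (τV ⟨v, P⟩))}
  let KE : ∀ e, Set (π₀Obj (A.T e)) := fun e => {Q | K (Sum.inr (Sum.inl (τE ⟨e, Q⟩)))}
  have hmem_iso : ∀ {e : 𝒢.graph.Edge} {X Y : 𝒢.E e} (g : X ⟶ Y) (ψ : Y ≅ A.T e)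
      (x : (FE e).obj (A.T e)),
      x ∈ Set.range ((FE e).map (g ≫ ψ.hom)) ↔ (FE e).map ψ.inv x ∈ Set.range ((FE e).map g) := by
    intro e X Y g ψ x
    have hw : ∀ w, (FE e).map ψ.inv ((FE e).map ψ.hom w) = w := fun w =>
      FintypeCat.hom_inv_id_apply ((FE e).mapIso ψ) w
    have hw' : ∀ w, (FE e).map ψ.hom ((FE e).map ψ.inv w) = w := fun w =>
      FintypeCat.inv_hom_id_apply ((FE e).mapIso ψ) w
    constructor
    · rintro ⟨z, rfl⟩
      exact ⟨z, by rw [Functor.map_comp, FintypeCat.comp_apply, hw]⟩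
    · rintro ⟨z, hz⟩
      exact ⟨z, by rw [Functor.map_comp, FintypeCat.comp_apply, hz, hw']⟩
  /- KEY: along `b ∈ e` abutting to `v`, the components of `T_e` under the `ψ_b(b^* P)`, `P ∈ KV v`,
  are exactly the `Q ∈ KE e`. -/
  have key : ∀ (b : 𝒢.graph.Branch) (v : 𝒢.graph.Vertex) (h : 𝒢.graph.abuts b = some v)
      (x : (FE (𝒢.graph.edgeOf b)).obj (A.T (𝒢.graph.edgeOf b))),
      (∃ P ∈ KV v, x ∈ Set.range ((FE _).map
          ((𝒢.pull b v h).pullback.map P.1.arrow ≫ (A.ψ b v h).hom))) ↔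
        ∃ Q ∈ KE (𝒢.graph.edgeOf b), x ∈ Set.range ((FE _).map Q.1.arrow) := by
    intro b v h x
    -- the component of `x` in `T_e`, as an edge `e''` of `𝔾'` over `e`, with a branch over `b`
    obtain ⟨Q₀, hQ₀x⟩ := exists_component_mem_range (FE _) x
    obtain ⟨e'', he''⟩ : ∃ e'', e'' = τE ⟨𝒢.graph.edgeOf b, Q₀⟩ := ⟨_, rfl⟩
    have hσe'' : σE e'' = ⟨𝒢.graph.edgeOf b, Q₀⟩ := by rw [he'']; exact hστE _
    have he''e : φ.base.edgeMap e'' = 𝒢.graph.edgeOf b := congrArg Sigma.fst hσe''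
    have hQ₀heq : HEq (cE e'') Q₀ := (Sigma.mk.inj_iff.mp hσe'').2
    obtain ⟨b'', v'', hb''e, hb''b, hv''a, hv''v⟩ :=
      SemiGraph.exists_branch_preimage_abuts φ.base hprop e'' b he''e.symm v h
    subst hb''b hv''v hb''e
    -- the branch clause at `b''`
    obtain ⟨f, hf⟩ := hbr b'' v'' hv''a
    have hsub := range_subset_of_branchClause A (φ.base.edgeOf_branchMap b'') (FE _)
      ((𝒢.pull _ _ (φ.base.abuts_branchMap b'' v'' hv''a)).pullback.map (cV v'').1.arrow ≫
        (A.ψ _ _ (φ.base.abuts_branchMap b'' v'' hv''a)).hom) (cE (𝒢'.graph.edgeOf b'')) f hf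
    rw [eqRec_component_eq A (φ.base.edgeOf_branchMap b'') (cE _) Q₀ hQ₀heq] at hsub
    -- `hsub : range (Q₀.arrow) ⊆ range (pull.map (cV v'').arrow ≫ ψ.hom)`
    have hKv''Q₀ : K (Sum.inl v'') ↔ Q₀ ∈ KE (𝒢.graph.edgeOf (φ.base.branchMap b'')) := by
      change K (Sum.inl v'') ↔ K (Sum.inr (Sum.inl (τE ⟨_, Q₀⟩)))
      rw [← he'', hKeb b'', hKbv b'' v'' hv''a]
    -- the fibre functor `b^* ⋙ F_e` of `𝒢_v`, to compare components of `S_v`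
    let F' : 𝒢.V (φ.base.vertexMap v'') ⥤ FintypeCat.{v₁} :=
      (𝒢.pull _ _ h).pullback ⋙ FE (𝒢.graph.edgeOf (φ.base.branchMap b''))
    haveI : FiberFunctor F' := fiberFunctor_comp_of_exact _ _
    have hrange : ∀ (P : π₀Obj (A.S (φ.base.vertexMap v''))) (y : (FE _).obj _),
        y ∈ Set.range ((FE (𝒢.graph.edgeOf (φ.base.branchMap b''))).map
          ((𝒢.pull _ _ h).pullback.map P.1.arrow ≫ (A.ψ _ _ h).hom)) →
        (FE _).map (A.ψ _ _ h).inv y ∈ Set.range (F'.map P.1.arrow) := fun P y hy =>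
      (hmem_iso _ _ y).mp hy
    constructor
    · rintro ⟨P, hP, hxP⟩
      have hx' := hsub hQ₀x
      have hPv : P = cV v'' :=
        component_eq_of_mem_range F' P (cV v'') (hrange P x hxP) (hrange (cV v'') x hx')
      subst hPv
      have hKv : K (Sum.inl v'') := by
        have : τV ⟨φ.base.vertexMap v'', cV v''⟩ = v'' := hτσV v''
        change K (Sum.inl (τV ⟨_, cV v''⟩)) at hP
        rwa [this] at hP
      exact ⟨Q₀, hKv''Q₀.mp hKv, hQ₀x⟩
    · rintro ⟨Q, hQ, hxQ⟩
      have hQQ₀ : Q = Q₀ := component_eq_of_mem_range (FE _) Q Q₀ hxQ hQ₀x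
      subst hQQ₀
      have hKv : K (Sum.inl v'') := hKv''Q₀.mpr hQ
      refine ⟨cV v'', ?_, hsub hxQ⟩
      change K (Sum.inl (τV ⟨_, cV v''⟩))
      rwa [show τV ⟨φ.base.vertexMap v'', cV v''⟩ = v'' from hτσV v'']
  have hreV : ∀ v, ∃ n : ℕ, Nonempty (KV v ≃ Fin n) := fun v => by
    haveI : Finite (π₀Obj (A.S v)) := finite_connectedSubobject _
    exact Finite.exists_equiv_fin _
  have hreE : ∀ e, ∃ n : ℕ, Nonempty (KE e ≃ Fin n) := fun e => by
    haveI : Finite (π₀Obj (A.T e)) := finite_connectedSubobject _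
    exact Finite.exists_equiv_fin _
  choose nV εV using hreV
  choose nE εE using hreE
  let ιV : ∀ v, Fin (nV v) → π₀Obj (A.S v) := fun v i => ((εV v).some.symm i).1
  let ιE : ∀ e, Fin (nE e) → π₀Obj (A.T e) := fun e i => ((εE e).some.symm i).1
  have hιV_mem : ∀ v i, ιV v i ∈ KV v := fun v i => ((εV v).some.symm i).2
  have hιE_mem : ∀ e i, ιE e i ∈ KE e := fun e i => ((εE e).some.symm i).2
  have hιV_surj : ∀ v (P : π₀Obj (A.S v)), P ∈ KV v → ∃ i, ιV v i = P := fun v P hP =>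
    ⟨(εV v).some ⟨P, hP⟩, by simp [ιV]⟩
  have hιE_surj : ∀ e (Q : π₀Obj (A.T e)), Q ∈ KE e → ∃ i, ιE e i = Q := fun e Q hQ =>
    ⟨(εE e).some ⟨Q, hQ⟩, by simp [ιE]⟩
  have hιV_inj : ∀ v, Function.Injective (ιV v) := fun v i j hij =>
    (εV v).some.symm.injective (Subtype.ext hij)
  have hιE_inj : ∀ e, Function.Injective (ιE e) := fun e i j hij =>
    (εE e).some.symm.injective (Subtype.ext hij)
  let ZS : ∀ v, 𝒢.V v := fun v => ∐ fun i : Fin (nV v) => ((ιV v i).1 : 𝒢.V v)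
  let ZT : ∀ e, 𝒢.E e := fun e => ∐ fun i : Fin (nE e) => ((ιE e i).1 : 𝒢.E e)
  let mS : ∀ v, ZS v ⟶ A.S v := fun v => Sigma.desc fun i => (ιV v i).1.arrow
  let mT : ∀ e, ZT e ⟶ A.T e := fun e => Sigma.desc fun i => (ιE e i).1.arrow
  have hrangeS : ∀ (v) (F : 𝒢.V v ⥤ FintypeCat.{v₁}) [FiberFunctor F] (y : F.obj (A.S v)),
      y ∈ Set.range (F.map (mS v)) ↔ ∃ P ∈ KV v, y ∈ Set.range (F.map P.1.arrow) := by
    intro v F _ y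
    change y ∈ Set.range (F.map (Sigma.desc fun i => (ιV v i).1.arrow)) ↔ _
    rw [range_map_sigmaDesc, Set.mem_iUnion]
    exact ⟨fun ⟨i, hi⟩ => ⟨ιV v i, hιV_mem v i, hi⟩, fun ⟨P, hP, hy⟩ => by
      obtain ⟨i, rfl⟩ := hιV_surj v P hP; exact ⟨i, hy⟩⟩
  have hrangeT : ∀ (e) (F : 𝒢.E e ⥤ FintypeCat.{v₁}) [FiberFunctor F] (y : F.obj (A.T e)),
      y ∈ Set.range (F.map (mT e)) ↔ ∃ Q ∈ KE e, y ∈ Set.range (F.map Q.1.arrow) := by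
    intro e F _ y
    change y ∈ Set.range (F.map (Sigma.desc fun i => (ιE e i).1.arrow)) ↔ _
    rw [range_map_sigmaDesc, Set.mem_iUnion]
    exact ⟨fun ⟨i, hi⟩ => ⟨ιE e i, hιE_mem e i, hi⟩, fun ⟨Q, hQ, hy⟩ => by
      obtain ⟨i, rfl⟩ := hιE_surj e Q hQ; exact ⟨i, hy⟩⟩
  haveI hmS : ∀ v, Mono (mS v) := fun v =>
    mono_sigmaDesc_of_pairwise_disjoint (FV v) _ fun i j hij =>
      Set.disjoint_left.mpr fun y hyi hyj =>
        hij (hιV_inj v (component_eq_of_mem_range (FV v) _ _ hyi hyj))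
  haveI hmT : ∀ e, Mono (mT e) := fun e =>
    mono_sigmaDesc_of_pairwise_disjoint (FE e) _ fun i j hij =>
      Set.disjoint_left.mpr fun y hyi hyj =>
        hij (hιE_inj e (component_eq_of_mem_range (FE e) _ _ hyi hyj))
  have hψrange : ∀ (b : 𝒢.graph.Branch) (v : 𝒢.graph.Vertex) (h : 𝒢.graph.abuts b = some v),
      Set.range ((FE _).map ((𝒢.pull b v h).pullback.map (mS v) ≫ (A.ψ b v h).hom)) =
        Set.range ((FE _).map (mT (𝒢.graph.edgeOf b))) := by
    intro b v h
    let F' : 𝒢.V v ⥤ FintypeCat.{v₁} := (𝒢.pull b v h).pullback ⋙ FE (𝒢.graph.edgeOf b)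
    haveI : FiberFunctor F' := fiberFunctor_comp_of_exact _ _
    ext x
    rw [hmem_iso, hrangeT]
    have h1 : (FE _).map (A.ψ b v h).inv x ∈
        Set.range ((FE _).map ((𝒢.pull b v h).pullback.map (mS v))) ↔
          ∃ P ∈ KV v, (FE _).map (A.ψ b v h).inv x ∈ Set.range (F'.map P.1.arrow) :=
      hrangeS v F' _
    refine h1.trans ?_
    rw [← key b v h x]
    refine exists_congr fun P => and_congr_right fun _ => ?_
    exact (hmem_iso ((𝒢.pull b v h).pullback.map P.1.arrow) (A.ψ b v h) x).symm
  have hψex : ∀ (b : 𝒢.graph.Branch) (v : 𝒢.graph.Vertex) (h : 𝒢.graph.abuts b = some v),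
      ∃ ε : (𝒢.pull b v h).pullback.obj (ZS v) ≅ ZT (𝒢.graph.edgeOf b),
        ε.hom ≫ mT _ = (𝒢.pull b v h).pullback.map (mS v) ≫ (A.ψ b v h).hom :=
    fun b v h => exists_iso_of_range_eq (FE _) _ _ (hψrange b v h)
  choose Zψ hZψ using hψex
  let Z : 𝒢.BObj := { S := ZS, T := ZT, ψ := Zψ }
  let m : Z ⟶ A := { fS := mS, fT := mT, comm := fun b v h => (hZψ b v h).symm }
  haveI : Mono m := mono_of_components m (fun v => hmS v) fun e => hmT e
  have hZ : IsInitial Z → False := by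
    intro hZ
    obtain ⟨-, hρ, hρE⟩ := hasColimitsOfShape_bObj (𝒢 := 𝒢) (J := Discrete PEmpty.{1})
    rcases hn₀ with ⟨v₀', hv₀⟩ | ⟨e₀', he₀⟩
    · haveI := hρ (φ.base.vertexMap v₀')
      have hinit : IsInitial (ZS (φ.base.vertexMap v₀')) :=
        IsInitial.isInitialObj (𝒢.ρ (φ.base.vertexMap v₀')) Z hZ
      haveI : IsEmpty ((FV _).obj (ZS (φ.base.vertexMap v₀'))) :=
        (initial_iff_fiber_empty (FV _) _).mp ⟨hinit⟩
      have hP : cV v₀' ∈ KV (φ.base.vertexMap v₀') := by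
        change K (Sum.inl (τV (σV v₀')))
        rw [hτσV]
        exact hv₀ ▸ hK₀
      haveI : PreGaloisCategory.IsConnected ((cV v₀').1 : 𝒢.V (φ.base.vertexMap v₀')) := (cV v₀').2
      obtain ⟨p⟩ := nonempty_fiber_of_isConnected (FV _) ((cV v₀').1 : 𝒢.V (φ.base.vertexMap v₀'))
      obtain ⟨z, -⟩ := (hrangeS _ (FV _) ((FV _).map (cV v₀').1.arrow p)).mpr ⟨cV v₀', hP, p, rfl⟩
      exact IsEmpty.false z
    · haveI := hρE (φ.base.edgeMap e₀')
      have hinit : IsInitial (ZT (φ.base.edgeMap e₀')) :=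
        IsInitial.isInitialObj (𝒢.ρE (φ.base.edgeMap e₀')) Z hZ
      haveI : IsEmpty ((FE _).obj (ZT (φ.base.edgeMap e₀'))) :=
        (initial_iff_fiber_empty (FE _) _).mp ⟨hinit⟩
      have hQ : cE e₀' ∈ KE (φ.base.edgeMap e₀') := by
        change K (Sum.inr (Sum.inl (τE (σE e₀'))))
        rw [hτσE]
        exact he₀ ▸ hK₀
      haveI : PreGaloisCategory.IsConnected ((cE e₀').1 : 𝒢.E (φ.base.edgeMap e₀')) := (cE e₀').2
      obtain ⟨p⟩ := nonempty_fiber_of_isConnected (FE _) ((cE e₀').1 : 𝒢.E (φ.base.edgeMap e₀'))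
      obtain ⟨z, -⟩ := (hrangeT _ (FE _) ((FE _).map (cE e₀').1.arrow p)).mpr ⟨cE e₀', hQ, p, rfl⟩
      exact IsEmpty.false z
  haveI : IsIso m := hA.noTrivialComponent Z m hZ
  have hallV : ∀ v' : 𝒢'.graph.Vertex, K (Sum.inl v') := by
    intro v'
    have hiso : IsIso ((FV _).map (mS (φ.base.vertexMap v'))) := by
      change IsIso ((FV _).map ((𝒢.ρ _).map m))
      infer_instance
    haveI : PreGaloisCategory.IsConnected ((cV v').1 : 𝒢.V (φ.base.vertexMap v')) := (cV v').2
    obtain ⟨p⟩ := nonempty_fiber_of_isConnected (FV _) ((cV v').1 : 𝒢.V (φ.base.vertexMap v'))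
    obtain ⟨z, hz⟩ := (ConcreteCategory.bijective_of_isIso ((FV _).map (mS _))).2
      ((FV _).map (cV v').1.arrow p)
    obtain ⟨P', hP', hp⟩ := (hrangeS _ (FV _) _).mp ⟨z, hz⟩
    have hPP' : cV v' = P' := component_eq_of_mem_range (FV _) _ _ ⟨p, rfl⟩ hp
    rw [← hPP'] at hP'
    change K (Sum.inl (τV (σV v'))) at hP'
    rwa [hτσV] at hP'
  have hallE : ∀ e' : 𝒢'.graph.Edge, K (Sum.inr (Sum.inl e')) := by
    intro e'
    have hiso : IsIso ((FE _).map (mT (φ.base.edgeMap e'))) := by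
      change IsIso ((FE _).map ((𝒢.ρE _).map m))
      infer_instance
    haveI : PreGaloisCategory.IsConnected ((cE e').1 : 𝒢.E (φ.base.edgeMap e')) := (cE e').2
    obtain ⟨p⟩ := nonempty_fiber_of_isConnected (FE _) ((cE e').1 : 𝒢.E (φ.base.edgeMap e'))
    obtain ⟨z, hz⟩ := (ConcreteCategory.bijective_of_isIso ((FE _).map (mT _))).2
      ((FE _).map (cE e').1.arrow p)
    obtain ⟨Q', hQ', hp⟩ := (hrangeT _ (FE _) _).mp ⟨z, hz⟩
    have hQQ' : cE e' = Q' := component_eq_of_mem_range (FE _) _ _ ⟨p, rfl⟩ hp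
    rw [← hQQ'] at hQ'
    change K (Sum.inr (Sum.inl (τE (σE e')))) at hQ'
    rwa [hτσE] at hQ'
  have hall : ∀ n : 𝒢'.graph.Node, K n := by
    rintro (v' | e' | b')
    · exact hallV v'
    · exact hallE e'
    · exact (hKeb b').mp (hallE _)
  refine ⟨⟨?_⟩⟩
  rw [SimpleGraph.connected_iff]
  exact ⟨fun m' n' => (hall m').symm.trans (hall n'), ⟨n₀⟩⟩

end SemiGraphOfAnabelioids

end Literature.AnabelianGeometry.SemiGraphs
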